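import Summits.QuantumAdvantage.QuantumAdvantage.Theorems.CubicForrelationNearExactIsExactCubicForm
import Summits.QuantumAdvantage.QuantumAdvantage.Theorems.CubicForrelationNearExactIsExactTwelveOddWeightLight

/-!
# Crux `CubicForrelation.NearExactIsExact` (stmt-QuantumAdvantage-14043) — the cubic form of a cubic SUPPORTED IN A HYPERPLANE

Certificate seat `b2b-cforr-cert` (gen 40).  HONEST FRAMING: kernel-checked folklore (standard axioms), the first "(L5) cell lemma" of the
Lean roadmap for `E1280-even` (HOME/b2b-cforr-cert-g39/E1280-HANDPROOFS.md §3, R2-PARTNER.md §2): Kasami–Tokura (`kt3_structure`) puts a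
light cell `ρ` of the adapted R2 frame inside an affine hyperplane `{⟨x,z⟩ = b}`; this file identifies its CUBIC FORM there.  Nothing about
`θ₁₂`; NOT summit progress.

* (parity additivity is the tree's `tow_parity_bxor`)
* `tch_factor`: if `supp ρ ⊆ {⟨x,z⟩ = b}` and `⟨v₀,z⟩ = 1` then `ρ = 1_{⟨x,z⟩ = b} · q` pointwise, with `q = D_{v₀}ρ = ρ ⊕ ρ(· ⊕ v₀)`.
* `tch_second_const`: the second differences of a quadratic do not depend on the base point.
* `tch_third_of_hyperplane` (**main**): for such a cubic `ρ`, with `B(s,t) = q(0) ⊕ q(t) ⊕ q(s) ⊕ q(s ⊕ t)` the (alternating, bilinear)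
  second-difference form of the quadratic `q`:  `D_uD_vD_wρ = ⟨u,z⟩B(v,w) ⊕ ⟨v,z⟩B(u,w) ⊕ ⟨w,z⟩B(u,v)` — the cubic form is `z ∧ B`
  (so `t̄ ∈ {T, x₁q₄, x₁q₆, x₁q₈}` according to the rank of `B` on `ker z`, the Kasami–Tokura classes of R2-PARTNER.md §2).

References: T. Kasami, N. Tokura (1970) Thm 1; C. Carlet (2021) §2.2.  Axioms: the standard three.
-/

set_option linter.dupNamespace false -- D-0017: single-problem summit ⇒ `QuantumAdvantage.QuantumAdvantage` by design

namespace Summit.QuantumAdvantage.QuantumAdvantage.Theorems.CubicForrelation.NearExactIsExact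

open Finset
open Literature.Computability.QuantumComplexity
open Literature.Computability.QuantumComplexity.BuzetChailloux (bxor zeroVec bxor_comm bxor_self bxor_zeroVec zeroVec_bxor
  bxor_bxor_cancel_left)

variable {k : ℕ}

section Hyperplane

variable (ρ : (Fin k → Bool) → Bool) (z v₀ : Fin k → Bool) (b : Bool)
  (hsupp : ∀ x, ρ x = true → decide (Odd #(univ.filter fun j => x j && z j)) = b)
  (hv₀ : decide (Odd #(univ.filter fun j => v₀ j && z j)) = true)
include hsupp hv₀

/-- **Factorisation.**  If `supp ρ ⊆ {⟨x,z⟩ = b}` and `⟨v₀,z⟩ = 1`, then `ρ(x) = [⟨x,z⟩ = b] · (ρ(x) ⊕ ρ(x ⊕ v₀))`. [folklore] -/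
theorem tch_factor (x : Fin k → Bool) :
    ρ x = (!(decide (Odd #(univ.filter fun j => x j && z j)) ^^ b) && (ρ x ^^ ρ (bxor x v₀))) := by
  have hx' : decide (Odd #(univ.filter fun j => (bxor x v₀) j && z j)) = (decide (Odd #(univ.filter fun j => x j && z j)) ^^ true) := by
    rw [tow_parity_bxor, hv₀]
  by_cases h1 : ρ x = true
  · have hp := hsupp x h1
    have h2 : ρ (bxor x v₀) = false := by
      by_contra hc
      rw [Bool.not_eq_false] at hc
      have := hsupp _ hc
      rw [hx', hp] at this
      revert this; cases b <;> decide
    rw [h1, h2, hp]; cases b <;> decide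
  · rw [Bool.not_eq_true] at h1
    rw [h1]
    by_cases h2 : ρ (bxor x v₀) = true
    · have hp := hsupp _ h2
      rw [hx'] at hp
      rw [h2]
      revert hp
      cases (decide (Odd #(univ.filter fun j => x j && z j))) <;> cases b <;> decide
    · rw [Bool.not_eq_true] at h2
      rw [h2]
      cases (decide (Odd #(univ.filter fun j => x j && z j))) <;> cases b <;> decide

end Hyperplane

/-- **Second differences of a quadratic are base-point independent**: for `deg q ≤ 2`,
`q(x) ⊕ q(x⊕t) ⊕ q(x⊕s) ⊕ q(x⊕s⊕t) = q(0) ⊕ q(t) ⊕ q(s) ⊕ q(s⊕t)`. [cite: Carlet2020, §2.2] -/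
theorem tch_second_const (q : (Fin k → Bool) → Bool) (hq : IsDegLeFun 2 q) (s t x : Fin k → Bool) :
    ((q x ^^ q (bxor x t)) ^^ (q (bxor x s) ^^ q (bxor (bxor x s) t))) =
      ((q zeroVec ^^ q (bxor zeroVec t)) ^^ (q (bxor zeroVec s) ^^ q (bxor (bxor zeroVec s) t))) := by
  have h1 : IsDegLeFun 1 (fun x => q x ^^ q (bxor x t)) := stub_derivDegree k 1 q t hq
  obtain ⟨p, hp, hF⟩ := stub_derivDegree k 0 _ s h1
  have hpC : p = MvPolynomial.C (p.coeff 0) := MvPolynomial.totalDegree_eq_zero_iff_eq_C.mp (Nat.le_zero.mp hp)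
  have e1 := hF x
  have e2 := hF zeroVec
  rw [hpC, polyPhase_C] at e1 e2
  exact e1.trans e2.symm

/-- **The cubic form of a cubic supported in a hyperplane.**  Let `deg ρ ≤ 3` with `supp ρ ⊆ {⟨x,z⟩ = b}`, `⟨v₀,z⟩ = 1`, `q = ρ ⊕ ρ(·⊕v₀)`
and `B(s,t) = q(0) ⊕ q(t) ⊕ q(s) ⊕ q(s⊕t)`.  Then for all `u, v, w, x`:
`D_uD_vD_wρ(x) = ⟨u,z⟩·B(v,w) ⊕ ⟨v,z⟩·B(u,w) ⊕ ⟨w,z⟩·B(u,v)`, i.e. the cubic form of `ρ` is `z ∧ B`. [this work; cite: KasamiTokura1970, Thm 1] -/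
theorem tch_third_of_hyperplane (ρ : (Fin k → Bool) → Bool) (hρ : IsDegLeFun 3 ρ) (z v₀ : Fin k → Bool) (b : Bool)
    (hsupp : ∀ x, ρ x = true → decide (Odd #(univ.filter fun j => x j && z j)) = b)
    (hv₀ : decide (Odd #(univ.filter fun j => v₀ j && z j)) = true) (u v w x : Fin k → Bool) :
    let q : (Fin k → Bool) → Bool := fun y => ρ y ^^ ρ (bxor y v₀)
    let B : (Fin k → Bool) → (Fin k → Bool) → Bool :=
      fun s t => (q zeroVec ^^ q (bxor zeroVec t)) ^^ (q (bxor zeroVec s) ^^ q (bxor (bxor zeroVec s) t))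
    (((ρ x ^^ ρ (bxor x w)) ^^ (ρ (bxor x v) ^^ ρ (bxor (bxor x v) w))) ^^
        ((ρ (bxor x u) ^^ ρ (bxor (bxor x u) w)) ^^ (ρ (bxor (bxor x u) v) ^^ ρ (bxor (bxor (bxor x u) v) w)))) =
      (((decide (Odd #(univ.filter fun j => u j && z j)) && B v w) ^^ (decide (Odd #(univ.filter fun j => v j && z j)) && B u w)) ^^
        (decide (Odd #(univ.filter fun j => w j && z j)) && B u v)) := by
  intro q B
  have hq : IsDegLeFun 2 q := stub_derivDegree k 2 ρ v₀ hρ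
  -- the factorisation `ρ = ℓ · q` at the eight points
  have hfac : ∀ y, ρ y = (!(decide (Odd #(univ.filter fun j => y j && z j)) ^^ b) && q y) :=
    fun y => tch_factor ρ z v₀ b hsupp hv₀ y
  -- parities of the eight points
  have hpar : ∀ y t : Fin k → Bool, decide (Odd #(univ.filter fun j => (bxor y t) j && z j)) =
      (decide (Odd #(univ.filter fun j => y j && z j)) ^^ decide (Odd #(univ.filter fun j => t j && z j))) :=
    fun y t => tow_parity_bxor y t z
  -- second differences of `q`
  have hS : ∀ y s t : Fin k → Bool, q (bxor (bxor y s) t) = ((q y ^^ q (bxor y t)) ^^ (q (bxor y s) ^^ B s t)) := by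
    intro y s t
    have h := tch_second_const q hq s t y
    have key : ∀ A B' C D E : Bool, ((A ^^ B') ^^ (C ^^ D)) = E → D = ((A ^^ B') ^^ (C ^^ E)) := by decide
    exact key _ _ _ _ _ h
  rw [hfac x, hfac (bxor x w), hfac (bxor x v), hfac (bxor (bxor x v) w), hfac (bxor x u), hfac (bxor (bxor x u) w),
    hfac (bxor (bxor x u) v), hfac (bxor (bxor (bxor x u) v) w)]
  rw [hS (bxor x u) v w, hS x u w, hS x u v, hS x v w]
  simp only [hpar]
  generalize decide (Odd #(univ.filter fun j => x j && z j)) = lam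
  generalize decide (Odd #(univ.filter fun j => u j && z j)) = zu
  generalize decide (Odd #(univ.filter fun j => v j && z j)) = zv
  generalize decide (Odd #(univ.filter fun j => w j && z j)) = zw
  generalize q x = Q0
  generalize q (bxor x u) = Qu
  generalize q (bxor x v) = Qv
  generalize q (bxor x w) = Qw
  generalize B u v = Buv
  generalize B u w = Buw
  generalize B v w = Bvw
  clear hfac hsupp
  revert lam zu zv zw Q0 Qu Qv Qw Buv Buw Bvw b
  decide

end Summit.QuantumAdvantage.QuantumAdvantage.Theorems.CubicForrelation.NearExactIsExact
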